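import Literature.Algebra.Homology.IteratedExtClass
import Mathlib.Algebra.Homology.DerivedCategory.Ext.Map
import HarnessLib

/-!
# Iterated connecting classes: exact functors, and the two vanishing lemmas behind "θ(ω) = 0 ⇒ lift"

Continuation of `IteratedExtClass.lean` (`θ(ω) = [ω̄] ∘ κ_n`, the `Ext`-class of a cocycle of an
exactly augmented cochain complex `0 → M → K⁰ → K¹ → ⋯`).

* `ExactAugmentation.mapFunctor` — an additive exact functor `Φ` carries exact augmentations to
  exact augmentations; `theta_mapFunctor`: `θ_{ΦK}(Φ ω) = Φ(θ_K(ω))` on `Ext`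
  (Mathlib's `Ext.mapExactFunctor`; used with `Φ = 𝓗om(E, –)` for a vector bundle `E`).
* `exists_ext_one_of_theta_eq_zero` — if a `2`-cocycle `ω : A → K²` has `θ(ω) = 0`, then the class
  `[ω̄] ∘ [T₁] ∈ Ext¹(A, Z¹)` lifts to `Ext¹(A, K⁰)` along `K⁰ ↠ Z¹` (the long exact `Ext(A, –)`
  sequence of `0 → Z⁰ → K⁰ → Z¹ → 0`).
* `exists_eq_comp_d_of_comp_eq_zero` — if moreover that lift dies under a morphism of augmented
  complexes `φ : K → K'` (`y ∘ [φ⁰] = 0`), then `ω ≫ φ²` is a COBOUNDARY `β ≫ d` in `K'`.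

Together with "every `Ext¹` class is an extension class" (`ExtOneShortExact.lean`) these give the
geometric content of the vanishing of a Čech obstruction class read in `Ext²`.

## References

* R. Godement, *Topologie algébrique et théorie des faisceaux*, Hermann (1958), II.5.9–5.10.
* R. Hartshorne, *Algebraic Geometry*, GTM 52 (1977), III.4. [Hartshorne1977]
-/

universe w w' v v' u u'

open CategoryTheory CategoryTheory.Limits CategoryTheory.Abelian HomologicalComplex

namespace Literature.Algebra.Homology

set_option backward.isDefEq.respectTransparency false
set_option backward.defeqAttrib.useBackward true

variable {C : Type u} [Category.{v} C] [Abelian C] {D : Type u'} [Category.{v'} D] [Abelian D]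

namespace ExactAugmentation

variable {K : CochainComplex C ℕ} {M : C}

/-! ### Exact functors -/

section Functor

variable (Φ : C ⥤ D) [Φ.Additive] [PreservesFiniteLimits Φ] [PreservesFiniteColimits Φ]

/-- The image of a cochain complex under a functor (Mathlib's `mapHomologicalComplex`).
[folklore] -/
noncomputable abbrev mapK (K : CochainComplex C ℕ) : CochainComplex D ℕ :=
  (Φ.mapHomologicalComplex _).obj K

/-- **Exact functors preserve exact augmentations.** [folklore] -/
noncomputable def mapFunctor (a : ExactAugmentation K M) :
    ExactAugmentation (mapK Φ K) (Φ.obj M) where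
  ε := Φ.map a.ε
  ε_d := by
    change Φ.map a.ε ≫ Φ.map (K.d 0 1) = 0
    rw [← Φ.map_comp, a.ε_d, Φ.map_zero]
  mono_ε := by haveI := a.mono_ε; infer_instance
  exact₀ := a.exact₀.map Φ
  exactAt_succ n := (a.exactAt_succ n).map Φ

/-- The comparison `Zⁿ(ΦK) ≅ Φ(Zⁿ K)` (an exact functor commutes with kernels). [folklore] -/
noncomputable def mapCyclesIso (n : ℕ) : (mapK Φ K).cycles n ≅ Φ.obj (K.cycles n) :=
  (K.sc n).mapCyclesIso Φ

/-- `(Zⁿ(ΦK) ≅ Φ Zⁿ) ≫ Φ(Zⁿ ↪ Kⁿ) = (Zⁿ(ΦK) ↪ ΦKⁿ)`. [folklore] -/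
@[reassoc (attr := simp)]
lemma mapCyclesIso_hom_map_iCycles (n : ℕ) :
    (mapCyclesIso Φ (K := K) n).hom ≫ Φ.map (K.iCycles n) = (mapK Φ K).iCycles n :=
  (K.sc n).mapCyclesIso_hom_iCycles Φ

/-- The inverse comparison followed by the inclusion of cycles. [folklore] -/
@[reassoc (attr := simp)]
lemma mapCyclesIso_inv_iCycles (n : ℕ) :
    (mapCyclesIso Φ (K := K) n).inv ≫ (mapK Φ K).iCycles n = Φ.map (K.iCycles n) := by
  rw [← mapCyclesIso_hom_map_iCycles, Iso.inv_hom_id_assoc]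

/-- `Φ(toCycles)` corresponds to `toCycles` of `ΦK`. [folklore] -/
@[reassoc]
lemma map_toCycles_comp_mapCyclesIso_inv (n : ℕ) :
    Φ.map (K.toCycles n (n + 1)) ≫ (mapCyclesIso Φ (K := K) (n + 1)).inv =
      (mapK Φ K).toCycles n (n + 1) := by
  rw [← cancel_mono ((mapK Φ K).iCycles (n + 1)), Category.assoc, mapCyclesIso_inv_iCycles,
    toCycles_i, ← Φ.map_comp, toCycles_i]
  rfl

variable [HasExt.{w} C] [HasExt.{w'} D] (a : ExactAugmentation K M)

/-- The iterated connecting classes of `ΦK` are the images of those of `K`: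
`[Zⁿ(ΦK) ≅ Φ Zⁿ] ∘ Φ(κ_n) = κ_n(ΦK)`. [folklore] -/
lemma mk₀_mapCyclesIso_hom_comp_kappa_map (n : ℕ) :
    (Ext.mk₀ (mapCyclesIso Φ (K := K) n).hom).comp ((a.kappa n).mapExactFunctor Φ) (zero_add _) =
      (a.mapFunctor Φ).kappa n := by
  induction n with
  | zero =>
    rw [kappa_zero, kappa_zero, Ext.mapExactFunctor_mk₀, Ext.mk₀_comp_mk₀]
    congr 1
    haveI := (a.mapFunctor Φ).mono_ε
    rw [← cancel_mono (a.mapFunctor Φ).ε]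
    change ((mapCyclesIso Φ 0).hom ≫ Φ.map a.isoCyclesZero.inv) ≫ Φ.map a.ε = _
    rw [isoCyclesZero_inv_ε, Category.assoc, ← Φ.map_comp, isoCyclesZero_inv_ε,
      mapCyclesIso_hom_map_iCycles]
  | succ n ih =>
    -- the image of `T_n(K)` under `Φ` is isomorphic to `T_n(ΦK)`
    have hT := (a.shortExact_T n).map_of_exact Φ
    let f : (T K n).map Φ ⟶ T (mapK Φ K) n :=
      { τ₁ := (mapCyclesIso Φ (K := K) n).inv, τ₂ := 𝟙 _, τ₃ := (mapCyclesIso Φ (K := K) (n + 1)).inv,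
        comm₁₂ := by
          change (mapCyclesIso Φ n).inv ≫ (mapK Φ K).iCycles n = Φ.map (K.iCycles n) ≫ 𝟙 _
          rw [Category.comp_id, mapCyclesIso_inv_iCycles]
        comm₂₃ := by
          change 𝟙 _ ≫ (mapK Φ K).toCycles n (n + 1) =
            Φ.map (K.toCycles n (n + 1)) ≫ (mapCyclesIso Φ (n + 1)).inv
          rw [Category.id_comp, map_toCycles_comp_mapCyclesIso_inv] }
    have hnat := ShortComplex.ShortExact.extClass_naturality hT ((a.mapFunctor Φ).shortExact_T n) f
    -- hnat : hT.extClass ∘ [e_n.inv] = [e_{n+1}.inv] ∘ [T_n(ΦK)]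
    rw [kappa_succ, kappa_succ, Ext.mapExactFunctor_comp, Ext.mapExactFunctor_extClass,
      ← Ext.comp_assoc (Ext.mk₀ _) _ _ (zero_add 1) (by omega) (by omega)]
    have h1 : (Ext.mk₀ (mapCyclesIso Φ (K := K) (n + 1)).hom).comp hT.extClass (zero_add 1) =
        ((a.mapFunctor Φ).shortExact_T n).extClass.comp (Ext.mk₀ (mapCyclesIso Φ (K := K) n).hom)
          (add_zero 1) := by
      have h2 : hT.extClass = (Ext.mk₀ (mapCyclesIso Φ (K := K) (n + 1)).inv).comp
          (((a.mapFunctor Φ).shortExact_T n).extClass.comp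
            (Ext.mk₀ (mapCyclesIso Φ (K := K) n).hom) (add_zero 1)) (zero_add 1) := by
        rw [← Ext.comp_assoc_of_third_deg_zero, ← hnat, Ext.comp_assoc_of_third_deg_zero,
          Ext.mk₀_comp_mk₀, Iso.inv_hom_id, Ext.comp_mk₀_id]
      rw [h2, Ext.mk₀_comp_mk₀_assoc, Iso.hom_inv_id, Ext.mk₀_id_comp]
    rw [h1, Ext.comp_assoc _ _ _ (add_zero 1) (zero_add n) (by omega), ih]

/-- **`θ` commutes with exact functors**: `θ_{ΦK}(Φ ω) = Φ(θ_K(ω))`. [folklore] -/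
theorem theta_mapFunctor {A : C} {n : ℕ} (ω : A ⟶ K.X n) (hω : ω ≫ K.d n (n + 1) = 0)
    (hω' : Φ.map ω ≫ (mapK Φ K).d n (n + 1) = 0) :
    (a.mapFunctor Φ).theta (Φ.map ω) hω' = (a.theta ω hω).mapExactFunctor Φ := by
  have hbar : bar (K := mapK Φ K) (Φ.map ω) hω' =
      Φ.map (bar ω hω) ≫ (mapCyclesIso Φ (K := K) n).inv := by
    rw [← cancel_mono ((mapK Φ K).iCycles n), Category.assoc, mapCyclesIso_inv_iCycles,
      ← Φ.map_comp]
    simp [bar]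
  rw [theta_def, theta_def, hbar, Ext.mapExactFunctor_comp, Ext.mapExactFunctor_mk₀,
    ← mk₀_mapCyclesIso_hom_comp_kappa_map, Ext.mk₀_comp_mk₀_assoc, Category.assoc, Iso.inv_hom_id,
    Category.comp_id]

omit [PreservesFiniteLimits Φ] [PreservesFiniteColimits Φ] [HasExt C] [HasExt D] in
/-- The cocycle condition is preserved by functors. [folklore] -/
lemma map_d_eq_zero {A : C} {n : ℕ} (ω : A ⟶ K.X n) (hω : ω ≫ K.d n (n + 1) = 0) :
    Φ.map ω ≫ (mapK Φ K).d n (n + 1) = 0 := by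
  change Φ.map ω ≫ Φ.map (K.d n (n + 1)) = 0
  rw [← Φ.map_comp, hω, Φ.map_zero]

end Functor

/-! ### The two vanishing lemmas -/

variable [HasExt.{w} C] (a : ExactAugmentation K M)

/-- **First step of "θ(ω) = 0 ⇒ coboundary"**: for a `2`-cocycle `ω : A → K²` with `θ(ω) = 0`,
the class `[ω̄] ∘ [T₁] ∈ Ext¹(A, Z¹)` lifts along `K⁰ ↠ Z¹` to some `y ∈ Ext¹(A, K⁰)` (exactness of
`Ext¹(A, K⁰) → Ext¹(A, Z¹) → Ext²(A, Z⁰)` for `0 → Z⁰ → K⁰ → Z¹ → 0`, and `Z⁰ ≅ M`).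
[folklore] -/
theorem exists_ext_one_of_theta_eq_zero {A : C} (ω : A ⟶ K.X 2) (hω : ω ≫ K.d 2 3 = 0)
    (h : a.theta ω hω = 0) :
    ∃ y : Ext.{w} A (K.X 0) 1, y.comp (Ext.mk₀ (K.toCycles 0 1)) (add_zero 1) =
      (Ext.mk₀ (bar ω hω)).comp (a.shortExact_T 1).extClass (zero_add 1) := by
  -- θ(ω) = ([ω̄] ∘ [T₁]) ∘ ([T₀] ∘ κ₀) with κ₀ an isomorphism class
  have h' : (((Ext.mk₀ (bar ω hω)).comp (a.shortExact_T 1).extClass (zero_add 1)).comp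
      (a.shortExact_T 0).extClass (rfl : 1 + 1 = 2)) = 0 := by
    have h1 : a.theta ω hω = ((((Ext.mk₀ (bar ω hω)).comp (a.shortExact_T 1).extClass
        (zero_add 1)).comp (a.shortExact_T 0).extClass (rfl : 1 + 1 = 2))).comp
          (Ext.mk₀ a.isoCyclesZero.inv) (add_zero 2) := by
      rw [theta_def, kappa_succ, kappa_succ, kappa_zero,
        ← Ext.comp_assoc (Ext.mk₀ _) _ _ (zero_add 1) (by omega) (by omega),
        ← Ext.comp_assoc_of_third_deg_zero]
    rw [h1] at h
    have h2 := congrArg (fun x => x.comp (Ext.mk₀ a.isoCyclesZero.hom) (add_zero 2)) h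
    simpa only [Ext.comp_assoc_of_third_deg_zero, Ext.mk₀_comp_mk₀, Iso.inv_hom_id,
      Ext.comp_mk₀_id, Ext.zero_comp] using h2
  exact Ext.covariant_sequence_exact₃ _ (a.shortExact_T 0) _ rfl h'

section Kill

/-- **Second step**: if the lift `y ∈ Ext¹(A, K⁰)` of `[ω̄] ∘ [T₁]` dies under a morphism of
complexes `φ : K → K'` (`y ∘ [φ⁰] = 0`; e.g. the extension `y` splits after a refinement of the
cover), then `ω ≫ φ²` is a coboundary in `K'`: `ω ≫ φ² = β ≫ d` for some `β : A → K'¹`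
(naturality of `[T₁]`, then exactness of `Hom(A, K'¹) → Hom(A, Z'²) → Ext¹(A, Z'¹)`).
[folklore] -/
theorem exists_eq_comp_d_of_comp_eq_zero {K' : CochainComplex C ℕ} {M' : C}
    (a' : ExactAugmentation K' M') (φ : K ⟶ K') {A : C} (ω : A ⟶ K.X 2) (hω : ω ≫ K.d 2 3 = 0)
    (y : Ext.{w} A (K.X 0) 1)
    (hy : y.comp (Ext.mk₀ (K.toCycles 0 1)) (add_zero 1) =
      (Ext.mk₀ (bar ω hω)).comp (a.shortExact_T 1).extClass (zero_add 1))
    (hkill : y.comp (Ext.mk₀ (φ.f 0)) (add_zero 1) = 0) :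
    ∃ β : A ⟶ K'.X 1, ω ≫ φ.f 2 = β ≫ K'.d 1 2 := by
  have hω' : (ω ≫ φ.f 2) ≫ K'.d 2 3 = 0 := comp_f_d_eq_zero φ ω hω
  have hbar : bar (ω ≫ φ.f 2) hω' = bar ω hω ≫ cyclesMap φ 2 := by
    rw [← cancel_mono (K'.iCycles 2)]
    simp [bar]
  -- naturality of `[T₁]` along `φ`
  let f : T K 1 ⟶ T K' 1 :=
    { τ₁ := cyclesMap φ 1, τ₂ := φ.f 1, τ₃ := cyclesMap φ 2,
      comm₁₂ := by simp,
      comm₂₃ := by simpa using (toCycles_comp_cyclesMap φ 1).symm }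
  have hnat := ShortComplex.ShortExact.extClass_naturality (a.shortExact_T 1)
    (a'.shortExact_T 1) f
  have hzero : (Ext.mk₀ (bar (ω ≫ φ.f 2) hω')).comp (a'.shortExact_T 1).extClass (zero_add 1)
      = 0 := by
    rw [hbar, ← Ext.mk₀_comp_mk₀_assoc]
    change (Ext.mk₀ (bar ω hω)).comp ((Ext.mk₀ f.τ₃).comp (a'.shortExact_T 1).extClass
      (zero_add 1)) (zero_add 1) = 0
    rw [← hnat, ← Ext.comp_assoc_of_third_deg_zero, ← hy, Ext.comp_assoc_of_third_deg_zero,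
      Ext.mk₀_comp_mk₀, toCycles_comp_cyclesMap, ← Ext.mk₀_comp_mk₀,
      ← Ext.comp_assoc_of_third_deg_zero, hkill, Ext.zero_comp]
  obtain ⟨x, hx⟩ := Ext.covariant_sequence_exact₃ _ (a'.shortExact_T 1)
    (Ext.mk₀ (bar (ω ≫ φ.f 2) hω')) (zero_add 1) hzero
  refine ⟨Ext.homEquiv₀ x, ?_⟩
  have hx' : Ext.homEquiv₀ x ≫ K'.toCycles 1 2 = bar (ω ≫ φ.f 2) hω' := by
    apply (Ext.mk₀_bijective _ _).1
    rw [← Ext.mk₀_comp_mk₀, Ext.mk₀_homEquiv₀_apply]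
    exact hx
  have := congrArg (· ≫ K'.iCycles 2) hx'
  simpa only [Category.assoc, toCycles_i, bar, liftCycles_i] using this.symm

end Kill

end ExactAugmentation

end Literature.Algebra.Homology
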